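/-
Copyright (c) 2026. All rights reserved.
Released under Apache 2.0 license as described in the file LICENSE.
Authors: abc-iut cell, wave-4 seat abc-iut-w4-d059 (proof-only; T54-B, «T54·stabBranchPairAug-ASSEMBLY»: the
capstone binder `stabBranchPairAug` PRODUCED at the canonical coset tower).
-/
import Literature.AnabelianGeometry.SemiGraphs.ArithBrGpBranchClassDictionary
import Literature.AnabelianGeometry.SemiGraphs.ArithBranchPairAug
import Literature.AnabelianGeometry.SemiGraphs.ArithVertGpFaithfulGeometric
import Literature.AnabelianGeometry.SemiGraphs.ArithThm54iCapstoneOuterAction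
import Literature.AnabelianGeometry.SemiGraphs.ArithLevelCofinalityOuterAction
import HarnessLib

/-!
# [SemiAnbd] Thm 5.4 (i) p. 66: the (AI4″) capstone binder `stabBranchPairAug` PRODUCED at the canonical
# coset tower of the Prop 3.6 chart (proof-only; row T54-B, «T54·stabBranchPairAug-ASSEMBLY»)

Mochizuki, *Semi-graphs of anabelioids*, Publ. RIMS **42** (2006), §5, proof of Thm 5.4 (i) p. 66
("entirely parallel" to Thm 3.7 (iii) p. 41: a compact subgroup of `Π^temp_𝔊` fixing a vertex together
with TWO of its branches in the tower of finite level semi-graphs lies, after conjugation, in the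
intersection of two branch-decomposition groups) [cite: MochizukiSemiAnbd2006, Thm 5.4 (i) p.66].

PROOF-ONLY (abc-iut cell, `plan/L3/SUBDAG-SemiAnbd-Thm54.md` row T54-B, seat abc-iut-w4-d059; the binder
`stabBranchPairAug` of abc-iut-w4-d029's capstones `arithMaximalCompactStatementI/II_outerAction_piPresentation`).
abc-iut-w4-d059's `map_aug_le_conj_of_levelDict'` (`ArithBranchPairAug.lean`) INSTANTIATED at the canonical
coset tower (`𝒢.galoisLevelData h36`, chart `𝒢.temperedPiChart h36`, `P := piPresentation T R`, finite levels
`L n := ker π_n`, actions `P.arithAct hP (L n)`, data `decompositionDataOfChart Rc ι`) for ANY arithmetic group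
`E ⊇ ι(π₁^temp(𝒢))` acting compatibly (`hP`, `hN`, `hιΦ`, `hισ`, semi-direct product relation `hιconj`,
`Φ_e` continuous) with `ker aug = ι(π₁^temp(𝒢))`, and representatives `Rc` MATCHED to the presentation
(`hRcV : Rc.Hv = H`, `hRcB : Rc.Hb b = s_b M s_b⁻¹`; they exist: `exists_chartRepresentatives_of_presentation`).
Inputs bound BY NAME: reference data = the standard classes `H_{v₀}·1·L_j`, `(b₀, M s_{b₀}⁻¹ L_j)`; (T1)/(T2) =
`exists_deck_translate_vertex_branch` / `exists_mem_H_deck_translate_branch`; `hωE`/`hωV` =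
`ArithVertGpNormalizerDictionary`; `hκE'`/`hκV` = `ArithBrGpBranchClassDictionary` (`hsep` from
abc-iut-L3-d4/w4-d085's `piPresentation_hfree`/`piPresentation_hMK`; estrangement input = abc-iut-w4-d083's
UNCONDITIONAL `hnobpNCpt_cosetTower_holds`); `hfaith` = abc-iut-w6-d072's `hfaith_geom_cosetTower_of_tower`.
RESIDUAL binders (honest): topology on `E` with `aug` continuous and open finite-level action kernels
(`haugc`, `hLopen`; at the outer model: abc-iut-w6-d070's `continuous_outerSemidirectProductSnd`,
`isOpen_ker_arithAct_of_le`), compact arithmetic vertex groups `hVc` (p. 65; abc-iut-w4-d040's lane — its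
`hVc_hBc_of_cosetTowerC` consumes `stabBranchPairAug`, an `Lc`-free form is wanted), arithmetic cofinality
`hcof` (⟺ pro-faithfulness of `Π_A`, abc-iut-w4-d085's `hcof_of_faithful_levels_nat`), `Π_A` compact Hausdorff.
Results: `stabBranchPairAug_cosetTower` (any such `E`); `stabBranchPairAug_outerAction` (the outer model
`π₁^temp(𝒢) ⋊^out Π_A`: exactness by abc-iut-L3-d2's `outerAction_exact`, `hιconj` by
`conj_toOuterSemidirectProduct`, `Φ_e` continuous as a member of `contMulAut`).
No definition, no new named fact; typed ≠ proved for the residual inputs; no side taken on [IUTchIII] Cor. 3.12.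
-/

namespace Literature.AnabelianGeometry.SemiGraphs

open CategoryTheory Topology
open Literature.AnabelianGeometry.EtaleTheta
open scoped Pointwise

universe u v

/-! ### Generic coset-tower plumbing -/

namespace SemiGraph

namespace SubgroupPresentation

variable {𝔾 : SemiGraph.{u}} {Γ : Type u} [Group Γ] (P : SubgroupPresentation 𝔾 Γ)
  {E : Type v} [Group E] {Φ : E →* MulAut Γ} {σ : E →* Aut 𝔾} (hP : P.IsArithCompatible Φ σ)

variable (N : Subgroup Γ) [N.Normal] (hN : ∀ (e : E) (x : Γ), x ∈ N → Φ e x ∈ N)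
  (ι : Γ →* E) (hιΦ : ∀ g : Γ, Φ (ι g) = MulAut.conj g) (hισ : ∀ g : Γ, σ (ι g) = 1)

include hιΦ hισ in
/-- **(T1) in `E`-form**: every (vertex, abutting branch) pair over `(v₀, b₀)` of the level-`N` coset
semi-graph is the translate by an element of `ι(Γ) ≤ E` of the standard pair
`(H_{v₀} · 1 · N, (b₀, M s_{b₀}⁻¹ N))`. [cite: MochizukiSemiAnbd2006, Thm 3.7(iii) p.41] -/
theorem exists_arith_translate_vertex_branch {v₀ : 𝔾.Vertex} (x : (P.cosetGraph N).Vertex)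
    (γ : (P.cosetGraph N).Branch) (b₀ : 𝔾.Branch) (hx : (P.cosetGraphProj N).vertexMap x = v₀)
    (hγ : (P.cosetGraph N).abuts γ = some x) (hb : (P.cosetGraphProj N).branchMap γ = b₀) :
    ∃ e : E, (P.arithAct hP N hN e).hom.vertexMap (P.vMk N v₀ 1) = x ∧
      (P.arithAct hP N hN e).hom.branchMap (P.bMk N b₀ (P.s b₀)⁻¹) = γ := by
  obtain ⟨w', y, rfl⟩ := P.vMk_surjective N x
  obtain ⟨b', z, rfl⟩ := P.bMk_surjective N γ
  change w' = v₀ at hx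
  change b' = b₀ at hb
  subst hx hb
  have hb₀ : 𝔾.abuts b' = some w' := (P.cosetGraphProj N).abuts_branchMap _ _ hγ
  obtain ⟨g, h1, h2⟩ := P.exists_deck_translate_vertex_branch N w' b' hb₀ y z hγ
  refine ⟨ι g, ?_, ?_⟩ <;> rw [P.arithAct_eq_deckAct_of_inner hP N hN (hιΦ g) (hισ g)]
  · exact h1
  · exact h2

omit hN hιΦ hισ in
/-- **(T2) in `Γ`-form**: every branch over `b₀` abutting to the standard vertex `H_{v₀} · 1 · N` is the
deck-translate of the standard branch by an element of `H_{v₀}`. [cite: MochizukiSemiAnbd2006, Thm 3.7(iii) p.41] -/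
theorem exists_mem_H_deck_translate_branch' {v₀ : 𝔾.Vertex} (γ : (P.cosetGraph N).Branch)
    (b₀ : 𝔾.Branch) (hγ : (P.cosetGraph N).abuts γ = some (P.vMk N v₀ 1))
    (hb : (P.cosetGraphProj N).branchMap γ = b₀) :
    ∃ g ∈ P.H v₀, (P.deckAct N g).hom.branchMap (P.bMk N b₀ (P.s b₀)⁻¹) = γ := by
  obtain ⟨b', z, rfl⟩ := P.bMk_surjective N γ
  change b' = b₀ at hb
  subst hb
  have hb₀ : 𝔾.abuts b' = some v₀ := (P.cosetGraphProj N).abuts_branchMap _ _ hγ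
  exact P.exists_mem_H_deck_translate_branch N v₀ b' hb₀ z hγ

omit hP [N.Normal] in
/-- **The separation input `hsep` of (E-B″) from `hfree` and `hMK`**: if the finite levels `L_j` meet
`H_{v₀}` inside the tree levels `K_j` (`hfree`) and `⋂_j M_ε · K_j = M_ε` (`hMK`), then an element of `H_{v₀}`
lying in `s_{b₀} M_ε s_{b₀}⁻¹ · L_j` for every `j` lies in `s_{b₀} M_ε s_{b₀}⁻¹`. [cite: MochizukiSemiAnbd2006, Thm 3.7(iii) p.41] -/
theorem hsep_of_hfree_hMK (K L : ℕ → Subgroup Γ) [∀ j, (K j).Normal] {v₀ : 𝔾.Vertex} {b₀ : 𝔾.Branch}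
    (hb₀ : 𝔾.abuts b₀ = some v₀) (hfree : ∀ (j : ℕ) (x : Γ), x ∈ L j → x ∈ P.H v₀ → x ∈ K j)
    (hMK : ∀ x : Γ, (∀ j, x ∈ (P.M (𝔾.edgeOf b₀) : Set Γ) * (K j : Set Γ)) → x ∈ P.M (𝔾.edgeOf b₀)) :
    ∀ c ∈ P.H v₀, (∀ n, ∃ μ ∈ P.M (𝔾.edgeOf b₀), ∃ y ∈ L n, c = P.s b₀ * μ * (P.s b₀)⁻¹ * y) →
      ∃ μ ∈ P.M (𝔾.edgeOf b₀), c = P.s b₀ * μ * (P.s b₀)⁻¹ := by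
  intro c hc h
  have key : ∀ n, (P.s b₀)⁻¹ * c * P.s b₀ ∈ (P.M (𝔾.edgeOf b₀) : Set Γ) * (K n : Set Γ) := by
    intro n
    obtain ⟨μ, hμ, y, hy, hcy⟩ := h n
    have hyH : y ∈ P.H v₀ := by
      have : y = (P.s b₀ * μ * (P.s b₀)⁻¹)⁻¹ * c := by rw [hcy]; group
      rw [this]
      exact (P.H v₀).mul_mem ((P.H v₀).inv_mem (P.conj_mem b₀ v₀ hb₀ μ hμ)) hc
    refine Set.mem_mul.mpr ⟨μ, hμ, (P.s b₀)⁻¹ * y * P.s b₀, ?_, ?_⟩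
    · have := (inferInstance : (K n).Normal).conj_mem y (hfree n y hy hyH) (P.s b₀)⁻¹
      rwa [inv_inv] at this
    · rw [hcy]; group
  exact ⟨(P.s b₀)⁻¹ * c * P.s b₀, hMK _ key, by group⟩

end SubgroupPresentation

end SemiGraph

/-! ### The capstone binder at the canonical coset tower -/

namespace ProfiniteSemiGraph

variable {𝒢 : ProfiniteSemiGraph.{u}}

/-- **`stabBranchPairAug` PRODUCED at the canonical coset tower, for any compatible arithmetic group `E`**
(binder text of `ArithLevelDataCpt.ofCosetTowerC` at `P := piPresentation T R`, `L n := ker π_n`): see the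
module docstring for the by-name inputs and the honest residual binders.
[cite: MochizukiSemiAnbd2006, Thm 5.4 (i) p.66] -/
theorem stabBranchPairAug_cosetTower (h36 : 𝒢.Prop36Hypotheses) (h37 : 𝒢.Thm37Hypotheses)
    [Finite 𝒢.graph.Vertex] [Finite 𝒢.graph.Branch]
    (hconn : ∀ (n : ℕ) (p q : ((𝒢.galoisLevelData h36).S n).Point),
      ((𝒢.galoisLevelData h36).S n).SameComponent p q)
    (T : ∀ w : 𝒢.graph.Vertex, (𝒢.galoisLevelData h36).PointSeq h36.isCountable w)
    (R : SemiGraph.RefBranches 𝒢.graph) {E : Type u} [Group E] [TopologicalSpace E] [IsTopologicalGroup E]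
    {Φ : E →* MulAut (𝒢.temperedPiChart h36).G} {σ : E →* Aut 𝒢.graph}
    (hP : ((𝒢.galoisLevelData h36).piPresentation h36.isCountable T R).IsArithCompatible Φ σ)
    (hN : ∀ (n : ℕ) (e : E) (x : (𝒢.temperedPiChart h36).G),
      x ∈ ((𝒢.galoisLevelData h36).piLevelAut h36.isCountable hconn n).ker →
        Φ e x ∈ ((𝒢.galoisLevelData h36).piLevelAut h36.isCountable hconn n).ker)
    (ι : (𝒢.temperedPiChart h36).G →* E) (hι : Function.Injective ι)
    (hιΦ : ∀ g, Φ (ι g) = MulAut.conj g) (hισ : ∀ g, σ (ι g) = 1)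
    (hιconj : ∀ (e : E) (x : (𝒢.temperedPiChart h36).G), e * ι x * e⁻¹ = ι (Φ e x))
    (hΦc : ∀ e : E, Continuous (Φ e))
    {PA : Type u} [Group PA] [TopologicalSpace PA] [IsTopologicalGroup PA] [CompactSpace PA] [T2Space PA]
    (aug : E →* PA) (haugc : Continuous aug) (haug : aug.ker = ι.range)
    (Rc : ChartRepresentatives (𝒢.temperedPiChart h36))
    (hRcV : ∀ v, Rc.Hv v = ((𝒢.galoisLevelData h36).piPresentation h36.isCountable T R).H v)
    (hRcB : ∀ b, Rc.Hb b = (((𝒢.galoisLevelData h36).piPresentation h36.isCountable T R).M (𝒢.graph.edgeOf b)).map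
      (MulAut.conj (((𝒢.galoisLevelData h36).piPresentation h36.isCountable T R).s b)).toMonoidHom)
    (hLopen : ∀ n, IsOpen ((((𝒢.galoisLevelData h36).piPresentation h36.isCountable T R).arithAct hP
      ((𝒢.galoisLevelData h36).piLevelAut h36.isCountable hconn n).ker (hN n)).ker : Set E))
    (hVc : ∀ v, IsCompact (((decompositionDataOfChart Rc ι).vertGp v : Subgroup E) : Set E))
    (hcof : ∀ U ∈ 𝓝 (1 : PA), ∃ j : ℕ, ∀ e ∈ (((𝒢.galoisLevelData h36).piPresentation h36.isCountable T R).arithAct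
      hP ((𝒢.galoisLevelData h36).piLevelAut h36.isCountable hconn j).ker (hN j)).ker, aug e ∈ U) :
    ∀ (C : Subgroup E), IsCompact (C : Set E) →
      ∀ (j₀ : ℕ) (w : ∀ i : {i : ℕ // j₀ ≤ i},
        (((𝒢.galoisLevelData h36).piPresentation h36.isCountable T R).cosetGraph
          ((𝒢.galoisLevelData h36).piLevelAut h36.isCountable hconn i.1).ker).Vertex)
      (β β' : ∀ i : {i : ℕ // j₀ ≤ i},
        (((𝒢.galoisLevelData h36).piPresentation h36.isCountable T R).cosetGraph
          ((𝒢.galoisLevelData h36).piLevelAut h36.isCountable hconn i.1).ker).Branch),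
      (∀ i, β i ≠ β' i ∧
        (((𝒢.galoisLevelData h36).piPresentation h36.isCountable T R).cosetGraph
          ((𝒢.galoisLevelData h36).piLevelAut h36.isCountable hconn i.1).ker).abuts (β i) = some (w i) ∧
        (((𝒢.galoisLevelData h36).piPresentation h36.isCountable T R).cosetGraph
          ((𝒢.galoisLevelData h36).piLevelAut h36.isCountable hconn i.1).ker).abuts (β' i) = some (w i)) →
      (∀ ⦃i i' : {i : ℕ // j₀ ≤ i}⦄ (h : i.1 ≤ i'.1),
        (((𝒢.galoisLevelData h36).piPresentation h36.isCountable T R).cosetGraphTrans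
            ((𝒢.galoisLevelData h36).ker_piLevelAut_anti h36.isCountable hconn h)).vertexMap (w i') = w i ∧
        (((𝒢.galoisLevelData h36).piPresentation h36.isCountable T R).cosetGraphTrans
            ((𝒢.galoisLevelData h36).ker_piLevelAut_anti h36.isCountable hconn h)).branchMap (β i') = β i ∧
        (((𝒢.galoisLevelData h36).piPresentation h36.isCountable T R).cosetGraphTrans
            ((𝒢.galoisLevelData h36).ker_piLevelAut_anti h36.isCountable hconn h)).branchMap (β' i') = β' i) →
      (∀ (i : {i : ℕ // j₀ ≤ i}) (g : E), g ∈ C →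
        (((𝒢.galoisLevelData h36).piPresentation h36.isCountable T R).arithAct hP
            ((𝒢.galoisLevelData h36).piLevelAut h36.isCountable hconn i.1).ker (hN i.1) g).hom.vertexMap
            (w i) = w i ∧
        (((𝒢.galoisLevelData h36).piPresentation h36.isCountable T R).arithAct hP
            ((𝒢.galoisLevelData h36).piLevelAut h36.isCountable hconn i.1).ker (hN i.1) g).hom.branchMap
            (β i) = β i ∧
        (((𝒢.galoisLevelData h36).piPresentation h36.isCountable T R).arithAct hP
            ((𝒢.galoisLevelData h36).piLevelAut h36.isCountable hconn i.1).ker (hN i.1) g).hom.branchMap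
            (β' i) = β' i) →
      ∃ (v : 𝒢.graph.Vertex) (b b' : 𝒢.graph.Branch) (a : PA) (h : E),
        (decompositionDataOfChart Rc ι).abut b = some v ∧ (decompositionDataOfChart Rc ι).abut b' = some v ∧
        h ∈ (decompositionDataOfChart Rc ι).vertGp v ∧ (b' ≠ b ∨ h ∉ (decompositionDataOfChart Rc ι).brGp b) ∧
        C.map aug ≤ conjSubgroup a (((decompositionDataOfChart Rc ι).brGp b ⊓
          conjSubgroup h ((decompositionDataOfChart Rc ι).brGp b')).map aug) := by
  intro C _hCc j₀ w β β' hpair hcompat hC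
  -- the finite levels of the canonical coset tower
  -- (normality of the level kernels, keyed to the chart's group structure for instance resolution)
  haveI hLn : ∀ j : ℕ, @Subgroup.Normal (𝒢.temperedPiChart h36).G (𝒢.temperedPiChart h36).group
      (((𝒢.galoisLevelData h36).piLevelAut h36.isCountable hconn j).ker) := fun _ => MonoidHom.normal_ker _
  haveI hfinQ : ∀ j : ℕ, Finite ((𝒢.temperedPiChart h36).G ⧸
      ((𝒢.galoisLevelData h36).piLevelAut h36.isCountable hconn j).ker) := fun j =>
    (𝒢.galoisLevelData h36).finite_quotient_ker_piLevelAut h36.isCountable hconn (𝒢.galoisLevelData_isFinite h36) j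
  haveI : ∀ j : ℕ, Finite (((𝒢.galoisLevelData h36).piPresentation h36.isCountable T R).cosetGraph
      ((𝒢.galoisLevelData h36).piLevelAut h36.isCountable hconn j).ker).Vertex := fun j =>
    ((𝒢.galoisLevelData h36).piPresentation h36.isCountable T R).finite_cosetGraph_vertex _
  haveI : ∀ j : ℕ, Finite (((𝒢.galoisLevelData h36).piPresentation h36.isCountable T R).cosetGraph
      ((𝒢.galoisLevelData h36).piLevelAut h36.isCountable hconn j).ker).Branch := fun j =>
    ((𝒢.galoisLevelData h36).piPresentation h36.isCountable T R).finite_cosetGraph_branch _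
  -- by-name inputs
  have hPH : ∀ w', ((𝒢.galoisLevelData h36).piPresentation h36.isCountable T R).H w' ∈
      verticialSubgroups (𝒢.temperedPiChart h36) w' := fun w' => by
    rw [GaloisLevelData.piPresentation_H]
    exact (T w').range_decompHom_mem_verticialSubgroups
  have hPM : ∀ ε, ((𝒢.galoisLevelData h36).piPresentation h36.isCountable T R).M ε ∈
      edgeLikeSubgroups (𝒢.temperedPiChart h36) ε := fun ε => piPresentation_M_mem_edgeLikeSubgroups h36 T R ε
  have hnobp := hnobpNCpt_cosetTower_holds h36 h37 hconn T R hP hN ι hιΦ hισ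
  refine map_aug_le_conj_of_levelDict'
    (fun j => ((𝒢.galoisLevelData h36).piPresentation h36.isCountable T R).cosetGraph
      ((𝒢.galoisLevelData h36).piLevelAut h36.isCountable hconn j).ker)
    (fun j => ((𝒢.galoisLevelData h36).piPresentation h36.isCountable T R).arithAct hP
      ((𝒢.galoisLevelData h36).piLevelAut h36.isCountable hconn j).ker (hN j))
    (fun i j h => ((𝒢.galoisLevelData h36).piPresentation h36.isCountable T R).cosetGraphTrans
      ((𝒢.galoisLevelData h36).ker_piLevelAut_anti h36.isCountable hconn h))
    aug haugc hLopen
    (fun i j h => ((𝒢.galoisLevelData h36).piPresentation h36.isCountable T R).ker_arithAct_anti hP (hN j)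
      (hN i) ((𝒢.galoisLevelData h36).ker_piLevelAut_anti h36.isCountable hconn h))
    (fun i j h e => ((𝒢.galoisLevelData h36).piPresentation h36.isCountable T R).arithAct_trans hP (hN j) (hN i)
      ((𝒢.galoisLevelData h36).ker_piLevelAut_anti h36.isCountable hconn h) e)
    (fun j => ((𝒢.galoisLevelData h36).piPresentation h36.isCountable T R).cosetGraphProj
      ((𝒢.galoisLevelData h36).piLevelAut h36.isCountable hconn j).ker)
    (fun i j h => ((𝒢.galoisLevelData h36).piPresentation h36.isCountable T R).cosetGraphTrans_comp_proj
      ((𝒢.galoisLevelData h36).ker_piLevelAut_anti h36.isCountable hconn h))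
    (w ⟨j₀, le_rfl⟩).1
    (fun j => ((𝒢.galoisLevelData h36).piPresentation h36.isCountable T R).vMk
      ((𝒢.galoisLevelData h36).piLevelAut h36.isCountable hconn j).ker (w ⟨j₀, le_rfl⟩).1 1)
    (fun _ => rfl) (fun _ _ _ => rfl)
    (fun b₀ j => ((𝒢.galoisLevelData h36).piPresentation h36.isCountable T R).bMk
      ((𝒢.galoisLevelData h36).piLevelAut h36.isCountable hconn j).ker b₀
      (((𝒢.galoisLevelData h36).piPresentation h36.isCountable T R).s b₀)⁻¹)
    (fun b₀ hb₀ => ⟨fun j => ⟨by rw [SemiGraph.SubgroupPresentation.cosetGraph_abuts_bMk _ _ b₀ _ hb₀,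
      mul_inv_cancel], rfl⟩, fun _ _ _ => rfl⟩)
    (fun j x γ b₀ hx hγ hb => ((𝒢.galoisLevelData h36).piPresentation h36.isCountable T R)
      |>.exists_arith_translate_vertex_branch hP _ (hN j) ι hιΦ hισ x γ b₀ hx hγ hb)
    ?_ j₀ w β β' hpair hcompat ?_ (decompositionDataOfChart Rc ι) (fun _ => rfl) (hVc _) ?_ ?_ ?_ ?_ hcof
    (hfaith_geom_cosetTower_of_tower h36 h37 hconn T R hP hN ι hι hιΦ hισ aug haug Rc _ j₀ w β β' hpair hcompat)
    C hC
  · -- (T2)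
    intro j γ b₀ hγ hb
    obtain ⟨g, hg, h2⟩ := ((𝒢.galoisLevelData h36).piPresentation h36.isCountable T R)
      |>.exists_mem_H_deck_translate_branch' _ γ b₀ hγ hb
    refine ⟨ι g, fun i => ?_, ?_⟩
    · rw [SemiGraph.SubgroupPresentation.arithAct_eq_deckAct_of_inner _ hP _ (hN i) (hιΦ g) (hισ g)]
      exact SemiGraph.SubgroupPresentation.deckAct_vMk_one_of_mem_H _ _ _ hg
    · rw [SemiGraph.SubgroupPresentation.arithAct_eq_deckAct_of_inner _ hP _ (hN j) (hιΦ g) (hισ g)]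
      exact h2
  · -- the base vertex of the given system
    intro i
    have h1 := (hcompat (show (⟨j₀, le_rfl⟩ : {i : ℕ // j₀ ≤ i}).1 ≤ i.1 from i.2)).1
    have h2 := congrArg (fun f : _ ⟶ 𝒢.graph => f.vertexMap (w i))
      (((𝒢.galoisLevelData h36).piPresentation h36.isCountable T R).cosetGraphTrans_comp_proj
        ((𝒢.galoisLevelData h36).ker_piLevelAut_anti h36.isCountable hconn
          (show (⟨j₀, le_rfl⟩ : {i : ℕ // j₀ ≤ i}).1 ≤ i.1 from i.2)))
    simp only [SemiGraph.comp_vertexMap, Function.comp_apply] at h2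
    rw [h1] at h2
    exact h2.symm
  · -- `hωE`
    intro j e he
    exact exists_mem_arithVertGp_of_fixes_vMk (𝒢.temperedPiChart h36) _ hP ι hιconj Rc hRcV _ (hN j) hιΦ hισ
      e he
  · -- `hωV`
    intro v hv j
    exact arithVertGp_fixes_vMk (𝒢.temperedPiChart h36) _ hP ι hι hιconj hPH Rc hRcV _ (hN j) hιΦ hισ h37 hv
  · -- `hκE'`
    intro b₀ hb₀ v hv hfix
    exact mem_arithBrGp_of_fixes_bMk (𝒢.temperedPiChart h36) _ hP ι hι hιconj hPH Rc hRcV hRcB h37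
      (fun n => ((𝒢.galoisLevelData h36).piLevelAut h36.isCountable hconn n).ker) hN hb₀ hv hfix
      (((𝒢.galoisLevelData h36).piPresentation h36.isCountable T R).hsep_of_hfree_hMK
        (fun n => ((𝒢.galoisLevelData h36).projAut h36.isCountable n).ker)
        (fun n => ((𝒢.galoisLevelData h36).piLevelAut h36.isCountable hconn n).ker) hb₀
        (fun j x hx hxH => (𝒢.galoisLevelData h36).piPresentation_hfree h36.isCountable hconn T R j _ 1 x hx
          (by rwa [one_mul, inv_one, mul_one]))
        ((𝒢.galoisLevelData h36).piPresentation_hMK h36.isCountable T R (𝒢.graph.edgeOf b₀)))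
  · -- `hκV`
    intro b₀ hb₀ v hv j
    exact ⟨arithVertGp_fixes_vMk (𝒢.temperedPiChart h36) _ hP ι hι hιconj hPH Rc hRcV _ (hN j) hιΦ hισ h37
        (arithBrGp_le_arithVertGp Rc ι hb₀ hv),
      arithBrGp_fixes_bMk (𝒢.temperedPiChart h36) _ hP ι hι hιconj hιΦ hισ hPH hPM Rc hRcV hRcB
        (fun n => ((𝒢.galoisLevelData h36).piLevelAut h36.isCountable hconn n).ker)
        ((𝒢.galoisLevelData h36).ker_piLevelAut_anti h36.isCountable hconn) hN h37 hΦc hnobp hb₀ hv j⟩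

/-! ### At the outer model `π₁^temp(𝒢) ⋊^out Π_A` of the T54-B capstones -/

/-- **`stabBranchPairAug` PRODUCED at the outer model** `E := π₁^temp(𝒢) ⋊^out Π_A` of abc-iut-w4-d029's
capstones `arithMaximalCompactStatementI/II_outerAction_piPresentation` (`ι := toOuterSemidirectProduct ρ'`,
`aug := outerSemidirectProductSnd ρ'`, `Φ`/`σ` the capstones'): their binder `stabBranchPairAug` VERBATIM
(at `h36`, `hconn` general; the capstones take `h37.toProp36Hypotheses`, `𝒢.galoisLevelData_hconn _`), from
`stabBranchPairAug_cosetTower` — exactness and injectivity by abc-iut-L3-d2's `outerAction_exact`, the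
semi-direct product relation by `conj_toOuterSemidirectProduct`, continuity of `Φ_e ∈ contMulAut`.
Residual binders: the topology instance on `E` with `aug` continuous (`haugc`) and open finite-level action
kernels (`hLopen`), compact arithmetic vertex groups (`hVc`), arithmetic cofinality (`hcof`), `Π_A` compact
Hausdorff, and representatives `Rc` matched to the presentation (`hRcV`, `hRcB`).
[cite: MochizukiSemiAnbd2006, Thm 5.4 (i) p.66] -/
theorem stabBranchPairAug_outerAction (h36 : 𝒢.Prop36Hypotheses) (h37 : 𝒢.Thm37Hypotheses)
    [Finite 𝒢.graph.Vertex] [Finite 𝒢.graph.Branch]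
    (hconn : ∀ (n : ℕ) (p q : ((𝒢.galoisLevelData h36).S n).Point),
      ((𝒢.galoisLevelData h36).S n).SameComponent p q)
    (T : ∀ w : 𝒢.graph.Vertex, (𝒢.galoisLevelData h36).PointSeq h36.isCountable w)
    (R : SemiGraph.RefBranches 𝒢.graph) {PA : Type u} [Group PA] [TopologicalSpace PA] [IsTopologicalGroup PA]
    [CompactSpace PA] [T2Space PA]
    (ρ' : PA →* TopOut (𝒢.temperedPiChart h36).G) (baseAct : PA →* Aut 𝒢.graph)
    [TopologicalSpace (outerSemidirectProduct ρ')] [IsTopologicalGroup (outerSemidirectProduct ρ')]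
    (hP : ((𝒢.galoisLevelData h36).piPresentation h36.isCountable T R).IsArithCompatible
      (((contMulAut (𝒢.temperedPiChart h36).G).subtype.comp
        (MonoidHom.fst (contMulAut (𝒢.temperedPiChart h36).G) PA)).comp (outerSemidirectProduct ρ').subtype)
      (baseAct.comp (outerSemidirectProductSnd ρ')))
    (hN : ∀ (n : ℕ) (e : outerSemidirectProduct ρ') (x : (𝒢.temperedPiChart h36).G),
      x ∈ ((𝒢.galoisLevelData h36).piLevelAut h36.isCountable hconn n).ker →
        (((contMulAut (𝒢.temperedPiChart h36).G).subtype.comp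
          (MonoidHom.fst (contMulAut (𝒢.temperedPiChart h36).G) PA)).comp (outerSemidirectProduct ρ').subtype)
          e x ∈ ((𝒢.galoisLevelData h36).piLevelAut h36.isCountable hconn n).ker)
    (haugc : Continuous (outerSemidirectProductSnd ρ'))
    (Rc : ChartRepresentatives (𝒢.temperedPiChart h36))
    (hRcV : ∀ v, Rc.Hv v = ((𝒢.galoisLevelData h36).piPresentation h36.isCountable T R).H v)
    (hRcB : ∀ b, Rc.Hb b = (((𝒢.galoisLevelData h36).piPresentation h36.isCountable T R).M (𝒢.graph.edgeOf b)).map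
      (MulAut.conj (((𝒢.galoisLevelData h36).piPresentation h36.isCountable T R).s b)).toMonoidHom)
    (hLopen : ∀ n, IsOpen ((((𝒢.galoisLevelData h36).piPresentation h36.isCountable T R).arithAct hP
      ((𝒢.galoisLevelData h36).piLevelAut h36.isCountable hconn n).ker (hN n)).ker : Set (outerSemidirectProduct ρ')))
    (hVc : ∀ v, IsCompact (((decompositionDataOfChart Rc (toOuterSemidirectProduct ρ')).vertGp v :
      Subgroup (outerSemidirectProduct ρ')) : Set (outerSemidirectProduct ρ')))
    (hcof : ∀ U ∈ 𝓝 (1 : PA), ∃ j : ℕ, ∀ e ∈ (((𝒢.galoisLevelData h36).piPresentation h36.isCountable T R).arithAct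
      hP ((𝒢.galoisLevelData h36).piLevelAut h36.isCountable hconn j).ker (hN j)).ker,
      outerSemidirectProductSnd ρ' e ∈ U) :
    ∀ (C : Subgroup (outerSemidirectProduct ρ')), IsCompact (C : Set (outerSemidirectProduct ρ')) →
      ∀ (j₀ : ℕ) (w : ∀ i : {i : ℕ // j₀ ≤ i},
        (((𝒢.galoisLevelData h36).piPresentation h36.isCountable T R).cosetGraph
          ((𝒢.galoisLevelData h36).piLevelAut h36.isCountable hconn i.1).ker).Vertex)
      (β β' : ∀ i : {i : ℕ // j₀ ≤ i},
        (((𝒢.galoisLevelData h36).piPresentation h36.isCountable T R).cosetGraph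
          ((𝒢.galoisLevelData h36).piLevelAut h36.isCountable hconn i.1).ker).Branch),
      (∀ i, β i ≠ β' i ∧
        (((𝒢.galoisLevelData h36).piPresentation h36.isCountable T R).cosetGraph
          ((𝒢.galoisLevelData h36).piLevelAut h36.isCountable hconn i.1).ker).abuts (β i) = some (w i) ∧
        (((𝒢.galoisLevelData h36).piPresentation h36.isCountable T R).cosetGraph
          ((𝒢.galoisLevelData h36).piLevelAut h36.isCountable hconn i.1).ker).abuts (β' i) = some (w i)) →
      (∀ ⦃i i' : {i : ℕ // j₀ ≤ i}⦄ (h : i.1 ≤ i'.1),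
        (((𝒢.galoisLevelData h36).piPresentation h36.isCountable T R).cosetGraphTrans
            ((𝒢.galoisLevelData h36).ker_piLevelAut_anti h36.isCountable hconn h)).vertexMap (w i') = w i ∧
        (((𝒢.galoisLevelData h36).piPresentation h36.isCountable T R).cosetGraphTrans
            ((𝒢.galoisLevelData h36).ker_piLevelAut_anti h36.isCountable hconn h)).branchMap (β i') = β i ∧
        (((𝒢.galoisLevelData h36).piPresentation h36.isCountable T R).cosetGraphTrans
            ((𝒢.galoisLevelData h36).ker_piLevelAut_anti h36.isCountable hconn h)).branchMap (β' i') = β' i) →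
      (∀ (i : {i : ℕ // j₀ ≤ i}) (g : outerSemidirectProduct ρ'), g ∈ C →
        (((𝒢.galoisLevelData h36).piPresentation h36.isCountable T R).arithAct hP
            ((𝒢.galoisLevelData h36).piLevelAut h36.isCountable hconn i.1).ker (hN i.1) g).hom.vertexMap
            (w i) = w i ∧
        (((𝒢.galoisLevelData h36).piPresentation h36.isCountable T R).arithAct hP
            ((𝒢.galoisLevelData h36).piLevelAut h36.isCountable hconn i.1).ker (hN i.1) g).hom.branchMap
            (β i) = β i ∧
        (((𝒢.galoisLevelData h36).piPresentation h36.isCountable T R).arithAct hP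
            ((𝒢.galoisLevelData h36).piLevelAut h36.isCountable hconn i.1).ker (hN i.1) g).hom.branchMap
            (β' i) = β' i) →
      ∃ (v : 𝒢.graph.Vertex) (b b' : 𝒢.graph.Branch) (a : PA) (h : outerSemidirectProduct ρ'),
        (decompositionDataOfChart Rc (toOuterSemidirectProduct ρ')).abut b = some v ∧
        (decompositionDataOfChart Rc (toOuterSemidirectProduct ρ')).abut b' = some v ∧
        h ∈ (decompositionDataOfChart Rc (toOuterSemidirectProduct ρ')).vertGp v ∧
        (b' ≠ b ∨ h ∉ (decompositionDataOfChart Rc (toOuterSemidirectProduct ρ')).brGp b) ∧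
        C.map (outerSemidirectProductSnd ρ') ≤ conjSubgroup a
          (((decompositionDataOfChart Rc (toOuterSemidirectProduct ρ')).brGp b ⊓
            conjSubgroup h ((decompositionDataOfChart Rc (toOuterSemidirectProduct ρ')).brGp b')).map
            (outerSemidirectProductSnd ρ')) := by
  obtain ⟨hι, hex, -⟩ := outerAction_exact (𝒢.temperedPiChart h36) ρ' h36
  have hισ : ∀ g : (𝒢.temperedPiChart h36).G,
      (baseAct.comp (outerSemidirectProductSnd ρ')) ((toOuterSemidirectProduct ρ') g) = 1 := fun g => by
    have hg : (toOuterSemidirectProduct ρ') g ∈ (outerSemidirectProductSnd ρ').ker := hex ▸ ⟨g, rfl⟩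
    rw [MonoidHom.comp_apply, (MonoidHom.mem_ker).mp hg, map_one]
  exact stabBranchPairAug_cosetTower h36 h37 hconn T R hP hN (toOuterSemidirectProduct ρ') hι (fun _ => rfl) hισ
    (fun e x => conj_toOuterSemidirectProduct ρ' e x) (fun e => e.1.1.2.1) (outerSemidirectProductSnd ρ') haugc
    hex.symm Rc hRcV hRcB hLopen hVc hcof

end ProfiniteSemiGraph

end Literature.AnabelianGeometry.SemiGraphs
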